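import Mathlib
import HarnessLib
import Summits.HubbardSuperconductivity.HubbardSuperconductivity.Theorems.ThermalWedgeTwPureThermalBoundDensityLimitD

/-!
# Route `ThermalWedge`, item `stmt-HubbardSuperconductivity-1702` (`TwPureThermalBound`):
# the abstract real analysis of the thermodynamic limit of sector energies — part E (no sign condition on
# the chemical potential: the particle–hole tilt)

Support file (`--supports stmt-HubbardSuperconductivity-1702`; pure real analysis, no definition). Part D
(`ptb_gsee_of_supportingLine`) derived the `T = 0` ensemble-equivalence inequality from a supporting slope
`μ ≤ 0`; the sign was used only to reach the high densities `K > L²` through the one-sided reflection (refl).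
Here the sign condition is REMOVED, given the two-sided, particle–hole type reflection
  (reflU) `|E L (2L² − K) − E L K − U'(L² − K)| ≤ R(L+1)` (`0 ≤ U'`, all `K ≤ 2L²`)
(for the Hubbard torus: exact particle–hole symmetry on the bipartite box, `E(2|Λ|−N) = E(N) + U(|Λ|−N)`,
plus the `O(L)` torus/box comparison). Two observations:
* **symmetry of the limit and `μ ≤ U'/2`**: (reflU) gives `e(2 − ν) = e(ν) + U'(1 − ν)` on `[3/4, 5/4]`
  (`ptb_eLim_reflect`), so by the three-slope inequality of the convex `e` a slope supporting `e` at
  `n ∈ [1/2, 1)` is `≤ U'/2` (`ptb_slope_le_half`);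
* **the tilt**: `Ẽ L K := E L K − (U'/2)K` satisfies (low, up, down, tile, fill) (`ptb_tilt_hyps`), its limit is
  `ẽ(ν) = e(ν) − (U'/2)ν` (`ptb_eLim_tilt`), (reflU) becomes EXACTLY the one-sided (refl) for `Ẽ`, and
  `μ − U'/2 ≤ 0` supports `ẽ`; part D applied to `Ẽ` is the inequality for `E` verbatim
  (`ptb_gsee_of_supportingLine_reflU`).
Folklore (Ruelle 1969 §3; Lieb–Wu 2003 §1 eq. (3) for the particle–hole relation).
-/

set_option linter.dupNamespace false

noncomputable section

namespace Summit.HubbardSuperconductivity.HubbardSuperconductivity.Theorems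

open Filter Set Finset
open scoped Topology BigOperators

/-- `⌊νL²⌋/L² → ν` for `ν ≥ 0`. [folklore] -/
theorem ptb_tendsto_floor_sq {ν : ℝ} (hν0 : 0 ≤ ν) :
    Tendsto (fun L : ℕ => (⌊ν * (L : ℝ) ^ 2⌋₊ : ℝ) / (L : ℝ) ^ 2) atTop (𝓝 ν) := by
  have hup : ∀ᶠ L : ℕ in atTop, (⌊ν * (L : ℝ) ^ 2⌋₊ : ℝ) / (L : ℝ) ^ 2 ≤ ν := by
    filter_upwards [eventually_ge_atTop 1] with L hL
    have hL1 : (1 : ℝ) ≤ L := by exact_mod_cast hL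
    have hLpos : (0 : ℝ) < L := by linarith
    have hL2 : (0 : ℝ) < (L : ℝ) ^ 2 := by positivity
    rw [div_le_iff₀ hL2]
    exact Nat.floor_le (by positivity)
  have hlow : ∀ᶠ L : ℕ in atTop, ν - 1 / (L : ℝ) ≤ (⌊ν * (L : ℝ) ^ 2⌋₊ : ℝ) / (L : ℝ) ^ 2 := by
    filter_upwards [eventually_ge_atTop 1] with L hL
    have hL1 : (1 : ℝ) ≤ L := by exact_mod_cast hL
    have hLpos : (0 : ℝ) < L := by linarith
    have hL2 : (0 : ℝ) < (L : ℝ) ^ 2 := by positivity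
    rw [le_div_iff₀ hL2]
    have h1 := Nat.lt_floor_add_one (ν * (L : ℝ) ^ 2)
    have h2 : (ν - 1 / (L : ℝ)) * (L : ℝ) ^ 2 = ν * (L : ℝ) ^ 2 - L := by
      field_simp
    rw [h2]
    linarith
  have h0 : Tendsto (fun L : ℕ => ν - 1 / (L : ℝ)) atTop (𝓝 (ν - 0)) :=
    tendsto_const_nhds.sub tendsto_one_div_atTop_nhds_zero_nat
  rw [sub_zero] at h0
  exact tendsto_of_tendsto_of_tendsto_of_le_of_le' h0 tendsto_const_nhds hlow hup

section Abstract

variable {E : ℕ → ℕ → ℝ} {c C T F : ℝ}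

/-! ### The tilt `Ẽ L K = E L K − aK` -/

/-- **The tilted energies satisfy the hypotheses of parts B–D** (with `c + 2a`, `C + a`, `T`, `F`). [folklore] -/
theorem ptb_tilt_hyps
    (hlow : ∀ L K : ℕ, K ≤ 2 * L ^ 2 → -(c * (L : ℝ) ^ 2) ≤ E L K)
    (hup : ∀ L K : ℕ, 2 * (K + 1) ≤ 3 * L ^ 2 → E L (K + 1) ≤ E L K + C)
    (hdn : ∀ L K : ℕ, 1 ≤ K → K ≤ 2 * L ^ 2 → E L (K - 1) ≤ E L K + C)
    (htile : ∀ (M k : ℕ) (Ns : Fin (k + 1) → Fin (k + 1) → ℕ), (∀ i j, Ns i j ≤ 2 * (M * M)) →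
      E ((k + 1) * M) (∑ i, ∑ j, Ns i j) ≤ ∑ i, ∑ j, E M (Ns i j) + T * M * k * (k + 1))
    (hfill : ∀ (ℓ r N NB : ℕ), N ≤ 2 * (ℓ * ℓ) → NB ≤ 2 * (r * ℓ + r * (ℓ + r)) →
      E (ℓ + r) (N + NB) ≤ E ℓ N + F * ((r * ℓ + r * (ℓ + r) : ℕ) + (2 * ℓ + r : ℕ)))
    {a : ℝ} (ha : 0 ≤ a) {E' : ℕ → ℕ → ℝ} (hE' : ∀ L K : ℕ, E' L K = E L K - a * K) :
    (∀ L K : ℕ, K ≤ 2 * L ^ 2 → -((c + 2 * a) * (L : ℝ) ^ 2) ≤ E' L K) ∧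
    (∀ L K : ℕ, 2 * (K + 1) ≤ 3 * L ^ 2 → E' L (K + 1) ≤ E' L K + (C + a)) ∧
    (∀ L K : ℕ, 1 ≤ K → K ≤ 2 * L ^ 2 → E' L (K - 1) ≤ E' L K + (C + a)) ∧
    (∀ (M k : ℕ) (Ns : Fin (k + 1) → Fin (k + 1) → ℕ), (∀ i j, Ns i j ≤ 2 * (M * M)) →
      E' ((k + 1) * M) (∑ i, ∑ j, Ns i j) ≤ ∑ i, ∑ j, E' M (Ns i j) + T * M * k * (k + 1)) ∧
    (∀ (ℓ r N NB : ℕ), N ≤ 2 * (ℓ * ℓ) → NB ≤ 2 * (r * ℓ + r * (ℓ + r)) →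
      E' (ℓ + r) (N + NB) ≤ E' ℓ N + F * ((r * ℓ + r * (ℓ + r) : ℕ) + (2 * ℓ + r : ℕ))) := by
  refine ⟨?_, ?_, ?_, ?_, ?_⟩
  · intro L K hK
    rw [hE']
    have h := hlow L K hK
    have hKr : (K : ℝ) ≤ 2 * (L : ℝ) ^ 2 := by exact_mod_cast hK
    have haK : a * K ≤ a * (2 * (L : ℝ) ^ 2) := mul_le_mul_of_nonneg_left hKr ha
    linarith
  · intro L K hK
    rw [hE', hE']
    have h := hup L K hK
    push_cast
    linarith
  · intro L K hK1 hK
    rw [hE', hE', Nat.cast_sub hK1, Nat.cast_one]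
    have h := hdn L K hK1 hK
    linarith
  · intro M k Ns hNs
    have h := htile M k Ns hNs
    simp only [hE']
    have hsum : (∑ i, ∑ j, (E M (Ns i j) - a * (Ns i j : ℝ))) =
        (∑ i, ∑ j, E M (Ns i j)) - a * ∑ i, ∑ j, (Ns i j : ℝ) := by
      simp only [Finset.sum_sub_distrib, Finset.mul_sum]
    rw [hsum]
    push_cast
    linarith
  · intro ℓ r N NB hN hNB
    rw [hE', hE']
    have h := hfill ℓ r N NB hN hNB
    have hNB0 : 0 ≤ a * (NB : ℝ) := by positivity
    push_cast at h ⊢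
    linarith

/-- **The limit of the tilted energies** is `ẽ(ν) = e(ν) − aν` on `[0, 5/4]` (both written as the explicit
infima of part B). [folklore] -/
theorem ptb_eLim_tilt (hc : 0 ≤ c) (hC : 0 ≤ C) (hT : 0 ≤ T) (hF : 0 ≤ F)
    (hlow : ∀ L K : ℕ, K ≤ 2 * L ^ 2 → -(c * (L : ℝ) ^ 2) ≤ E L K)
    (hup : ∀ L K : ℕ, 2 * (K + 1) ≤ 3 * L ^ 2 → E L (K + 1) ≤ E L K + C)
    (hdn : ∀ L K : ℕ, 1 ≤ K → K ≤ 2 * L ^ 2 → E L (K - 1) ≤ E L K + C)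
    (htile : ∀ (M k : ℕ) (Ns : Fin (k + 1) → Fin (k + 1) → ℕ), (∀ i j, Ns i j ≤ 2 * (M * M)) →
      E ((k + 1) * M) (∑ i, ∑ j, Ns i j) ≤ ∑ i, ∑ j, E M (Ns i j) + T * M * k * (k + 1))
    (hfill : ∀ (ℓ r N NB : ℕ), N ≤ 2 * (ℓ * ℓ) → NB ≤ 2 * (r * ℓ + r * (ℓ + r)) →
      E (ℓ + r) (N + NB) ≤ E ℓ N + F * ((r * ℓ + r * (ℓ + r) : ℕ) + (2 * ℓ + r : ℕ)))
    {a : ℝ} (ha : 0 ≤ a) {E' : ℕ → ℕ → ℝ} (hE' : ∀ L K : ℕ, E' L K = E L K - a * K)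
    {ν : ℝ} (hν0 : 0 ≤ ν) (hν : ν ≤ 5 / 4) :
    sInf ((fun M : ℕ => E' M ⌊ν * (M : ℝ) ^ 2⌋₊ / (M : ℝ) ^ 2 + (2 * (C + a) + T) / M) '' {M | 2 ≤ M}) =
      sInf ((fun M : ℕ => E M ⌊ν * (M : ℝ) ^ 2⌋₊ / (M : ℝ) ^ 2 + (2 * C + T) / M) '' {M | 2 ≤ M}) - a * ν := by
  obtain ⟨hlow', hup', hdn', htile', hfill'⟩ := ptb_tilt_hyps hlow hup hdn htile hfill ha hE'
  have hc' : 0 ≤ c + 2 * a := by positivity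
  have hC' : 0 ≤ C + a := by positivity
  have h1 := ptb_tendsto_sectorDensity hc' hC' hT hF hlow' hup' hdn' htile' hfill' hν0 hν
  have h2 := ptb_tendsto_sectorDensity hc hC hT hF hlow hup hdn htile hfill hν0 hν
  have h3 : Tendsto (fun L : ℕ => E' L ⌊ν * (L : ℝ) ^ 2⌋₊ / (L : ℝ) ^ 2) atTop
      (𝓝 (sInf ((fun M : ℕ => E M ⌊ν * (M : ℝ) ^ 2⌋₊ / (M : ℝ) ^ 2 + (2 * C + T) / M) '' {M | 2 ≤ M}) -
        a * ν)) := by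
    have h4 := h2.sub ((ptb_tendsto_floor_sq hν0).const_mul a)
    refine h4.congr' ?_
    filter_upwards [eventually_ge_atTop 1] with L hL
    have hL1 : (1 : ℝ) ≤ L := by exact_mod_cast hL
    have hLpos : (0 : ℝ) < L := by linarith
    have hL2 : (0 : ℝ) < (L : ℝ) ^ 2 := by positivity
    rw [hE']
    field_simp
  exact tendsto_nhds_unique h1 h3

/-! ### Reflection symmetry of the limit and the bound on the slope -/

/-- **Particle–hole symmetry of the limit**: under (reflU), `e(2 − ν) = e(ν) + U'(1 − ν)` for
`ν ∈ [3/4, 5/4]`. [folklore] -/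
theorem ptb_eLim_reflect (hc : 0 ≤ c) (hC : 0 ≤ C) (hT : 0 ≤ T) (hF : 0 ≤ F)
    (hlow : ∀ L K : ℕ, K ≤ 2 * L ^ 2 → -(c * (L : ℝ) ^ 2) ≤ E L K)
    (hup : ∀ L K : ℕ, 2 * (K + 1) ≤ 3 * L ^ 2 → E L (K + 1) ≤ E L K + C)
    (hdn : ∀ L K : ℕ, 1 ≤ K → K ≤ 2 * L ^ 2 → E L (K - 1) ≤ E L K + C)
    (htile : ∀ (M k : ℕ) (Ns : Fin (k + 1) → Fin (k + 1) → ℕ), (∀ i j, Ns i j ≤ 2 * (M * M)) →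
      E ((k + 1) * M) (∑ i, ∑ j, Ns i j) ≤ ∑ i, ∑ j, E M (Ns i j) + T * M * k * (k + 1))
    (hfill : ∀ (ℓ r N NB : ℕ), N ≤ 2 * (ℓ * ℓ) → NB ≤ 2 * (r * ℓ + r * (ℓ + r)) →
      E (ℓ + r) (N + NB) ≤ E ℓ N + F * ((r * ℓ + r * (ℓ + r) : ℕ) + (2 * ℓ + r : ℕ)))
    {U' R : ℝ} (hU' : 0 ≤ U') (hR : 0 ≤ R)
    (hreflU : ∀ L K : ℕ, K ≤ 2 * L ^ 2 →
      |E L (2 * L ^ 2 - K) - E L K - U' * ((L : ℝ) ^ 2 - K)| ≤ R * ((L : ℝ) + 1))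
    {ν : ℝ} (hν0 : 3 / 4 ≤ ν) (hν : ν ≤ 5 / 4) :
    sInf ((fun M : ℕ => E M ⌊(2 - ν) * (M : ℝ) ^ 2⌋₊ / (M : ℝ) ^ 2 + (2 * C + T) / M) '' {M | 2 ≤ M}) =
      sInf ((fun M : ℕ => E M ⌊ν * (M : ℝ) ^ 2⌋₊ / (M : ℝ) ^ 2 + (2 * C + T) / M) '' {M | 2 ≤ M}) +
        U' * (1 - ν) := by
  set e : ℝ → ℝ := fun ν => sInf ((fun M : ℕ => E M ⌊ν * (M : ℝ) ^ 2⌋₊ / (M : ℝ) ^ 2 + (2 * C + T) / M) '' {M | 2 ≤ M})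
    with he
  have hν0' : 0 ≤ ν := by linarith
  have h2ν0 : 0 ≤ 2 - ν := by linarith
  have h2ν : 2 - ν ≤ 5 / 4 := by linarith
  have ha := ptb_tendsto_sectorDensity hc hC hT hF hlow hup hdn htile hfill h2ν0 h2ν
  have hb := ptb_tendsto_sectorDensity hc hC hT hF hlow hup hdn htile hfill hν0' hν
  change Tendsto (fun L : ℕ => E L ⌊(2 - ν) * (L : ℝ) ^ 2⌋₊ / (L : ℝ) ^ 2) atTop (𝓝 (e (2 - ν))) at ha
  change Tendsto (fun L : ℕ => E L ⌊ν * (L : ℝ) ^ 2⌋₊ / (L : ℝ) ^ 2) atTop (𝓝 (e ν)) at hb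
  change e (2 - ν) = e ν + U' * (1 - ν)
  -- the difference of the two density sequences tends to `U'(1 − ν)`
  set D : ℝ := 2 * C + 2 * R + U' with hD
  have hbound : ∀ᶠ L : ℕ in atTop,
      |E L ⌊(2 - ν) * (L : ℝ) ^ 2⌋₊ / (L : ℝ) ^ 2 - E L ⌊ν * (L : ℝ) ^ 2⌋₊ / (L : ℝ) ^ 2 - U' * (1 - ν)| ≤
        D / L := by
    filter_upwards [eventually_ge_atTop 2] with L hL
    have hL2 : (2 : ℝ) ≤ L := by exact_mod_cast hL
    have hLpos : (0 : ℝ) < L := by linarith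
    have hL2pos : (0 : ℝ) < (L : ℝ) ^ 2 := by positivity
    set K : ℕ := ⌊ν * (L : ℝ) ^ 2⌋₊ with hKdef
    set K₂ : ℕ := ⌊(2 - ν) * (L : ℝ) ^ 2⌋₊ with hK₂def
    have hKle : (K : ℝ) ≤ ν * (L : ℝ) ^ 2 := Nat.floor_le (by positivity)
    have hKlt : ν * (L : ℝ) ^ 2 < K + 1 := Nat.lt_floor_add_one _
    have hK₂le : (K₂ : ℝ) ≤ (2 - ν) * (L : ℝ) ^ 2 := Nat.floor_le (by positivity)
    have hK₂lt : (2 - ν) * (L : ℝ) ^ 2 < K₂ + 1 := Nat.lt_floor_add_one _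
    have hK2 : K ≤ 2 * L ^ 2 := ptb_floor_le_two_mul_sq hν0' hν L
    -- (reflU) at `K`
    have hr := hreflU L K hK2
    have hcast : ((2 * L ^ 2 - K : ℕ) : ℝ) = 2 * (L : ℝ) ^ 2 - K := by
      rw [Nat.cast_sub hK2]; push_cast; ring
    -- `E L K₂` versus `E L (2L² − K)`: the indices differ by at most `2`
    have h3a : 2 * K₂ ≤ 3 * L ^ 2 := by
      have : (2 * K₂ : ℝ) ≤ 3 * (L : ℝ) ^ 2 := by nlinarith
      exact_mod_cast this
    have h3b : 2 * (2 * L ^ 2 - K) ≤ 3 * L ^ 2 := by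
      have h4 : (4 : ℝ) ≤ (L : ℝ) ^ 2 := by nlinarith
      have : (2 * (2 * (L : ℝ) ^ 2 - K)) ≤ 3 * (L : ℝ) ^ 2 := by nlinarith
      have : ((2 * (2 * L ^ 2 - K) : ℕ) : ℝ) ≤ 3 * (L : ℝ) ^ 2 := by push_cast [Nat.cast_sub hK2]; linarith
      exact_mod_cast this
    have hLip := ptb_abs_E_sub_E_le hup hdn L K₂ (2 * L ^ 2 - K) h3a h3b
    rw [hcast] at hLip
    have hidx : |(K₂ : ℝ) - (2 * (L : ℝ) ^ 2 - K)| ≤ 2 := by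
      rw [abs_le]; constructor <;> linarith
    have hLip2 : |E L K₂ - E L (2 * L ^ 2 - K)| ≤ 2 * C := by
      calc |E L K₂ - E L (2 * L ^ 2 - K)| ≤ C * |(K₂ : ℝ) - (2 * (L : ℝ) ^ 2 - K)| := hLip
        _ ≤ C * 2 := mul_le_mul_of_nonneg_left hidx hC
        _ = 2 * C := by ring
    -- assemble `|E L K₂ − E L K − U'(1 − ν)L²| ≤ 2C + R(L+1) + U'`
    have hU1 : |U' * ((L : ℝ) ^ 2 - K) - U' * (1 - ν) * (L : ℝ) ^ 2| ≤ U' := by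
      rw [show U' * ((L : ℝ) ^ 2 - K) - U' * (1 - ν) * (L : ℝ) ^ 2 = U' * (ν * (L : ℝ) ^ 2 - K) by ring,
        abs_mul, abs_of_nonneg hU']
      have : |ν * (L : ℝ) ^ 2 - K| ≤ 1 := by rw [abs_le]; constructor <;> linarith
      calc U' * |ν * (L : ℝ) ^ 2 - K| ≤ U' * 1 := mul_le_mul_of_nonneg_left this hU'
        _ = U' := mul_one _
    have htot : |E L K₂ - E L K - U' * (1 - ν) * (L : ℝ) ^ 2| ≤ 2 * C + R * ((L : ℝ) + 1) + U' := by
      have e1 : E L K₂ - E L K - U' * (1 - ν) * (L : ℝ) ^ 2 =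
          (E L K₂ - E L (2 * L ^ 2 - K)) + (E L (2 * L ^ 2 - K) - E L K - U' * ((L : ℝ) ^ 2 - K)) +
            (U' * ((L : ℝ) ^ 2 - K) - U' * (1 - ν) * (L : ℝ) ^ 2) := by ring
      rw [e1]
      calc _ ≤ |E L K₂ - E L (2 * L ^ 2 - K) + (E L (2 * L ^ 2 - K) - E L K - U' * ((L : ℝ) ^ 2 - K))| +
            |U' * ((L : ℝ) ^ 2 - K) - U' * (1 - ν) * (L : ℝ) ^ 2| := abs_add_le _ _
        _ ≤ (|E L K₂ - E L (2 * L ^ 2 - K)| + |E L (2 * L ^ 2 - K) - E L K - U' * ((L : ℝ) ^ 2 - K)|) +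
            |U' * ((L : ℝ) ^ 2 - K) - U' * (1 - ν) * (L : ℝ) ^ 2| :=
              add_le_add_left (abs_add_le _ _) _
        _ ≤ (2 * C + R * ((L : ℝ) + 1)) + U' := add_le_add (add_le_add hLip2 hr) hU1
        _ = 2 * C + R * ((L : ℝ) + 1) + U' := by ring
    -- divide by `L²` and bound by `D/L`
    have e2 : E L K₂ / (L : ℝ) ^ 2 - E L K / (L : ℝ) ^ 2 - U' * (1 - ν) =
        (E L K₂ - E L K - U' * (1 - ν) * (L : ℝ) ^ 2) / (L : ℝ) ^ 2 := by
      field_simp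
    rw [e2, abs_div, abs_of_pos hL2pos, div_le_div_iff₀ hL2pos hLpos]
    have hL1 : (1 : ℝ) ≤ L := by linarith
    have step : (2 * C + R * ((L : ℝ) + 1) + U') * L ≤ D * (L : ℝ) ^ 2 := by
      rw [hD]
      have h5 : R * ((L : ℝ) + 1) ≤ 2 * R * L := by nlinarith
      have h6 : (2 * C + U') * L ≤ (2 * C + U') * (L : ℝ) ^ 2 := by
        have : (L : ℝ) ≤ (L : ℝ) ^ 2 := by nlinarith
        exact mul_le_mul_of_nonneg_left this (by positivity)
      nlinarith
    calc |E L K₂ - E L K - U' * (1 - ν) * (L : ℝ) ^ 2| * L ≤ (2 * C + R * ((L : ℝ) + 1) + U') * L :=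
          mul_le_mul_of_nonneg_right htot hLpos.le
      _ ≤ D * (L : ℝ) ^ 2 := step
  have hdiff : Tendsto (fun L : ℕ => E L ⌊(2 - ν) * (L : ℝ) ^ 2⌋₊ / (L : ℝ) ^ 2 -
      E L ⌊ν * (L : ℝ) ^ 2⌋₊ / (L : ℝ) ^ 2) atTop (𝓝 (U' * (1 - ν))) := by
    have hDL : Tendsto (fun L : ℕ => D / (L : ℝ)) atTop (𝓝 0) := tendsto_const_div_atTop_nhds_zero_nat D
    have hlo : Tendsto (fun L : ℕ => U' * (1 - ν) - D / (L : ℝ)) atTop (𝓝 (U' * (1 - ν) - 0)) :=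
      tendsto_const_nhds.sub hDL
    have hhi : Tendsto (fun L : ℕ => U' * (1 - ν) + D / (L : ℝ)) atTop (𝓝 (U' * (1 - ν) + 0)) :=
      tendsto_const_nhds.add hDL
    rw [sub_zero] at hlo
    rw [add_zero] at hhi
    refine tendsto_of_tendsto_of_tendsto_of_le_of_le' hlo hhi ?_ ?_
    · filter_upwards [hbound] with L hL
      have h := (abs_le.1 hL).1
      linarith
    · filter_upwards [hbound] with L hL
      have h := (abs_le.1 hL).2
      linarith
  have huniq := tendsto_nhds_unique (ha.sub hb) hdiff
  linarith

/-- **A supporting slope is at most `U'/2`.** If `μ` supports the convex limit `e` at `n ∈ [1/2, 1)` over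
`[0, 5/4]` and (reflU) holds, then `μ ≤ U'/2`: with `a = (1+n)/2`, `b = (3−n)/2 = 2 − a`,
`μ ≤ (e a − e n)/(a − n) ≤ (e b − e a)/(b − a) = U'(1 − a)/(b − a) = U'/2`. [folklore] -/
theorem ptb_slope_le_half (hc : 0 ≤ c) (hC : 0 ≤ C) (hT : 0 ≤ T) (hF : 0 ≤ F)
    (hlow : ∀ L K : ℕ, K ≤ 2 * L ^ 2 → -(c * (L : ℝ) ^ 2) ≤ E L K)
    (hup : ∀ L K : ℕ, 2 * (K + 1) ≤ 3 * L ^ 2 → E L (K + 1) ≤ E L K + C)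
    (hdn : ∀ L K : ℕ, 1 ≤ K → K ≤ 2 * L ^ 2 → E L (K - 1) ≤ E L K + C)
    (htile : ∀ (M k : ℕ) (Ns : Fin (k + 1) → Fin (k + 1) → ℕ), (∀ i j, Ns i j ≤ 2 * (M * M)) →
      E ((k + 1) * M) (∑ i, ∑ j, Ns i j) ≤ ∑ i, ∑ j, E M (Ns i j) + T * M * k * (k + 1))
    (hfill : ∀ (ℓ r N NB : ℕ), N ≤ 2 * (ℓ * ℓ) → NB ≤ 2 * (r * ℓ + r * (ℓ + r)) →
      E (ℓ + r) (N + NB) ≤ E ℓ N + F * ((r * ℓ + r * (ℓ + r) : ℕ) + (2 * ℓ + r : ℕ)))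
    {U' R : ℝ} (hU' : 0 ≤ U') (hR : 0 ≤ R)
    (hreflU : ∀ L K : ℕ, K ≤ 2 * L ^ 2 →
      |E L (2 * L ^ 2 - K) - E L K - U' * ((L : ℝ) ^ 2 - K)| ≤ R * ((L : ℝ) + 1))
    {n μ : ℝ} (hn0 : 1 / 2 ≤ n) (hn1 : n < 1)
    (hsupp : ∀ ν ∈ Icc (0 : ℝ) (5 / 4),
      sInf ((fun M : ℕ => E M ⌊n * (M : ℝ) ^ 2⌋₊ / (M : ℝ) ^ 2 + (2 * C + T) / M) '' {M | 2 ≤ M}) + μ * (ν - n) ≤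
        sInf ((fun M : ℕ => E M ⌊ν * (M : ℝ) ^ 2⌋₊ / (M : ℝ) ^ 2 + (2 * C + T) / M) '' {M | 2 ≤ M})) :
    μ ≤ U' / 2 := by
  set e : ℝ → ℝ := fun ν => sInf ((fun M : ℕ => E M ⌊ν * (M : ℝ) ^ 2⌋₊ / (M : ℝ) ^ 2 + (2 * C + T) / M) '' {M | 2 ≤ M})
    with he
  have hconv := ptb_convexOn_eLim hc hC hT hF hlow hup hdn htile hfill
  change ConvexOn ℝ (Icc (0 : ℝ) (5 / 4)) e at hconv
  set a : ℝ := (1 + n) / 2 with hadef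
  set b : ℝ := (3 - n) / 2 with hbdef
  have hna : n < a := by rw [hadef]; linarith
  have hab : a < b := by rw [hadef, hbdef]; linarith
  have ha34 : 3 / 4 ≤ a := by rw [hadef]; linarith
  have ha54 : a ≤ 5 / 4 := by rw [hadef]; linarith
  have hn_mem : n ∈ Icc (0 : ℝ) (5 / 4) := ⟨by linarith, by linarith⟩
  have ha_mem : a ∈ Icc (0 : ℝ) (5 / 4) := ⟨by linarith, ha54⟩
  have hb_mem : b ∈ Icc (0 : ℝ) (5 / 4) := ⟨by rw [hbdef]; linarith, by rw [hbdef]; linarith⟩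
  -- symmetry: `e b = e a + U'(1 − a)`
  have hsym := ptb_eLim_reflect hc hC hT hF hlow hup hdn htile hfill hU' hR hreflU ha34 ha54
  change e (2 - a) = e a + U' * (1 - a) at hsym
  have h2a : 2 - a = b := by rw [hadef, hbdef]; ring
  rw [h2a] at hsym
  -- three slopes
  have hslope := hconv.slope_mono_adjacent hn_mem hb_mem hna hab
  have han : 0 < a - n := by linarith
  have hba : 0 < b - a := by linarith
  rw [div_le_div_iff₀ han hba, hsym] at hslope
  have hsup := hsupp a ha_mem
  change e n + μ * (a - n) ≤ e a at hsup
  -- `(e a − e n)(b − a) ≤ U'(1 − a)(a − n)` with `b − a = 1 − n`, `1 − a = a − n = (1 − n)/2`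
  have hba' : b - a = 1 - n := by rw [hadef, hbdef]; ring
  have h1a : 1 - a = (1 - n) / 2 := by rw [hadef]; ring
  have han' : a - n = (1 - n) / 2 := by rw [hadef]; ring
  rw [hba', h1a, han'] at hslope
  rw [han'] at hsup
  have h1n : 0 < 1 - n := by linarith
  -- `e a − e n ≤ U'(1 − n)/4`
  have hX : e a - e n ≤ U' * (1 - n) / 4 := by
    have h3 : (e a - e n) * (1 - n) ≤ (U' * (1 - n) / 4) * (1 - n) := by nlinarith
    exact le_of_mul_le_mul_right h3 h1n
  have h4 : μ * ((1 - n) / 2) ≤ (U' / 2) * ((1 - n) / 2) := by nlinarith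
  exact le_of_mul_le_mul_right h4 (by linarith)

/-! ### The ensemble-equivalence form without sign condition -/

/-- **GSEE form, no sign condition.** Under the hypotheses of parts B–C, the two-sided reflection (reflU)
with `U' ≥ 0`, a slope `μ` supporting `e` at `n ∈ [1/2, 1)` over `[0, 5/4]`, and `|N_L − nL²| ≤ 2`: for
every `ε > 0`, eventually in `L`, `E L N_L − μN_L ≤ E L K − μK + εL²` for all `K ≤ 2L²`. (Part D for the
tilted energies `E L K − (U'/2)K`, whose supporting slope `μ − U'/2` is `≤ 0` by `ptb_slope_le_half`.)
[folklore] -/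
theorem ptb_gsee_of_supportingLine_reflU (hc : 0 ≤ c) (hC : 0 ≤ C) (hT : 0 ≤ T) (hF : 0 ≤ F)
    {R U' : ℝ} (hR : 0 ≤ R) (hU' : 0 ≤ U')
    (hlow : ∀ L K : ℕ, K ≤ 2 * L ^ 2 → -(c * (L : ℝ) ^ 2) ≤ E L K)
    (hup : ∀ L K : ℕ, 2 * (K + 1) ≤ 3 * L ^ 2 → E L (K + 1) ≤ E L K + C)
    (hdn : ∀ L K : ℕ, 1 ≤ K → K ≤ 2 * L ^ 2 → E L (K - 1) ≤ E L K + C)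
    (htile : ∀ (M k : ℕ) (Ns : Fin (k + 1) → Fin (k + 1) → ℕ), (∀ i j, Ns i j ≤ 2 * (M * M)) →
      E ((k + 1) * M) (∑ i, ∑ j, Ns i j) ≤ ∑ i, ∑ j, E M (Ns i j) + T * M * k * (k + 1))
    (hfill : ∀ (ℓ r N NB : ℕ), N ≤ 2 * (ℓ * ℓ) → NB ≤ 2 * (r * ℓ + r * (ℓ + r)) →
      E (ℓ + r) (N + NB) ≤ E ℓ N + F * ((r * ℓ + r * (ℓ + r) : ℕ) + (2 * ℓ + r : ℕ)))
    (hreflU : ∀ L K : ℕ, K ≤ 2 * L ^ 2 →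
      |E L (2 * L ^ 2 - K) - E L K - U' * ((L : ℝ) ^ 2 - K)| ≤ R * ((L : ℝ) + 1))
    {n μ : ℝ} (hn0 : 1 / 2 ≤ n) (hn1 : n < 1)
    (hsupp : ∀ ν ∈ Icc (0 : ℝ) (5 / 4),
      sInf ((fun M : ℕ => E M ⌊n * (M : ℝ) ^ 2⌋₊ / (M : ℝ) ^ 2 + (2 * C + T) / M) '' {M | 2 ≤ M}) + μ * (ν - n) ≤
        sInf ((fun M : ℕ => E M ⌊ν * (M : ℝ) ^ 2⌋₊ / (M : ℝ) ^ 2 + (2 * C + T) / M) '' {M | 2 ≤ M}))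
    {NL : ℕ → ℕ} (hNL : ∀ L : ℕ, |(NL L : ℝ) - n * (L : ℝ) ^ 2| ≤ 2)
    {ε : ℝ} (hε : 0 < ε) :
    ∃ L₀ : ℕ, ∀ L : ℕ, L₀ ≤ L → ∀ K : ℕ, K ≤ 2 * L ^ 2 →
      E L (NL L) - μ * (NL L) ≤ E L K - μ * K + ε * (L : ℝ) ^ 2 := by
  obtain ⟨E', hE'⟩ : ∃ E' : ℕ → ℕ → ℝ, ∀ L K : ℕ, E' L K = E L K - U' / 2 * K :=
    ⟨fun L K => E L K - U' / 2 * K, fun _ _ => rfl⟩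
  have ha : 0 ≤ U' / 2 := by positivity
  obtain ⟨hlow', hup', hdn', htile', hfill'⟩ := ptb_tilt_hyps hlow hup hdn htile hfill ha hE'
  have hc' : 0 ≤ c + 2 * (U' / 2) := by positivity
  have hC' : 0 ≤ C + U' / 2 := by positivity
  -- (reflU) for `E` is the one-sided (refl) for the tilt
  have hrefl' : ∀ L K : ℕ, L ^ 2 ≤ K → K ≤ 2 * L ^ 2 →
      E' L (2 * L ^ 2 - K) ≤ E' L K + R * ((L : ℝ) + 1) := by
    intro L K _ hK
    rw [hE', hE', Nat.cast_sub hK]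
    have h := (abs_le.1 (hreflU L K hK)).2
    push_cast
    nlinarith [h]
  -- the tilted slope is `≤ 0`
  have hμ' : μ - U' / 2 ≤ 0 := by
    have := ptb_slope_le_half hc hC hT hF hlow hup hdn htile hfill hU' hR hreflU hn0 hn1 hsupp
    linarith
  -- the tilted slope supports the tilted limit
  have hsupp' : ∀ ν ∈ Icc (0 : ℝ) (5 / 4),
      sInf ((fun M : ℕ => E' M ⌊n * (M : ℝ) ^ 2⌋₊ / (M : ℝ) ^ 2 + (2 * (C + U' / 2) + T) / M) '' {M | 2 ≤ M}) +
          (μ - U' / 2) * (ν - n) ≤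
        sInf ((fun M : ℕ => E' M ⌊ν * (M : ℝ) ^ 2⌋₊ / (M : ℝ) ^ 2 + (2 * (C + U' / 2) + T) / M) '' {M | 2 ≤ M}) := by
    intro ν hν
    rw [ptb_eLim_tilt hc hC hT hF hlow hup hdn htile hfill ha hE' (by linarith) (by linarith),
      ptb_eLim_tilt hc hC hT hF hlow hup hdn htile hfill ha hE' hν.1 hν.2]
    have h := hsupp ν hν
    have e1 : (μ - U' / 2) * (ν - n) = μ * (ν - n) - U' / 2 * ν + U' / 2 * n := by ring
    rw [e1]
    linarith
  obtain ⟨L₀, hL₀⟩ := ptb_gsee_of_supportingLine hc' hC' hT hF hR hlow' hup' hdn' htile' hfill' hrefl'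
    (n := n) (μ := μ - U' / 2) (by linarith) hn1.le hμ' hsupp' hNL hε
  refine ⟨L₀, fun L hL K hK => ?_⟩
  have h := hL₀ L hL K hK
  rw [hE', hE'] at h
  have e1 : (μ - U' / 2) * (NL L : ℝ) = μ * (NL L : ℝ) - U' / 2 * (NL L : ℝ) := by ring
  have e2 : (μ - U' / 2) * (K : ℝ) = μ * (K : ℝ) - U' / 2 * (K : ℝ) := by ring
  rw [e1, e2] at h
  linarith

end Abstract

end Summit.HubbardSuperconductivity.HubbardSuperconductivity.Theorems

end
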